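import Literature.IUT.HodgeTheaters.TemperedCoveringsCor23LevelsGraph
import Mathlib.Topology.Algebra.Group.Pointwise
import HarnessLib

/-!
# [IUTchI] Cor. 2.3 at the levels: the TEMPERED dictionary row B1 (c) from its PROFINITE (closure) form

Mochizuki, *Inter-universal Teichmüller theory I*, kurims manuscript (May 2020), §2, Cor. 2.3 (ii) p. 47,
verbatim: "The closure of `Δ^tp_{X,ℍ} ⊆ Δ^tp_X ⊆ Δ̂_X` in `Δ̂_X` is equal to `Δ̂_{X,ℍ}`."  (Only this
`Δ`-statement is printed in (ii), and only it is used in this file; any analogous statement about the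
closure of `Π^tp_{X,ℍ}` in `Π̂_X` would be OUR gloss, is not attributed to print, and is not used here.)
Together with the levels of the proof of Prop. 2.4 (i), p. 50 l. 27–42 ([IUTchI] Cor 2.3 pp.47-50)
[claim: Mochizuki2012, status: disputed]; consumed at *Inter-universal Teichmüller theory II* Cor. 2.4 (i),
proof p. 71 l. 1–3: "it follows that `γ′ ∈ Δ̂^±_{v□}` — where we use the notation "∧" to denote the closure
in `Δ̂^±_v`".

abc-iut cell, sub-DAG plan/L5/SUBDAG-IUTchI-Cor23Levels.md (carrier: abc-iut-L5-t11,
`TemperedCoveringsCor23LevelsSub.lean`; B4 core at the semi-graph-covering instantiation: this seat,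
`TemperedCoveringsCor23LevelsGraph.lean`).  The carrier's dictionary row B1 (c) `StabLeDeltaHLevel` asks,
for a TEMPERED `γ ∈ Δ^tp_X` stabilising `ℍ̃_i`, for a TEMPERED `k ∈ Δ^tp_{X,ℍ}` with `k⁻¹γ ∈ J_i`.  What a
decomposition-group dictionary at the finite level `i` naturally supplies is the PROFINITE form
(hypothesis `hhat` below, no new name): "`Stab_{Δ^tp_X}(ℍ̃_i) ⊆ Δ̂_{X,ℍ} · (Ĵ_i ∩ Δ̂_X)`" with the closed
decomposition group `Δ̂_{X,ℍ}` (`deltaHatH`) — print's own "∧ = closure".  PROOF-ONLY file (seat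
abc-iut-w4-d076; no definition, no new fact):

* `SubgraphLevelData.stabLeDeltaHLevel_of_hat` — **B1 (c) tempered ⇐ B1 (c) profinite + Cor. 2.3 (ii) +
  `LevelsOpen`**: by Cor. 2.3 (ii) `Δ̂_{X,ℍ}` is the closure of `ι(Δ^tp_{X,ℍ})`, and for the OPEN subgroup
  `U := Ĵ_i ∩ Δ̂_X` of `Δ̂_X` one has `closure(A) · U = A · U` (Mathlib `IsOpen.closure_mul`), so
  `ι(γ) = ι(k) · u` with `k ∈ Δ^tp_{X,ℍ}` tempered and `u ∈ Ĵ_i`, i.e. `k⁻¹γ ∈ J_i := ι⁻¹(Ĵ_i)`;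
* `SubgraphLevelData.levelTarget_of_hat`, `CoveringLevelGraphs.toLevelData_levelTarget_of_hat` — the
  carrier's `LevelTarget` (hence the L6 consumer's `hlevel`) from base-level Cor. 2.3 (i)(ii), B3
  `LevelIncidence`, the PROFINITE dictionary `hhat`, and (abstractly) `IsBlock` / (at the semi-graph-covering
  instantiation) nothing else.

So the sub-DAG's tempered residual `StabLeDeltaHLevel` is traded for its closure form, which is the shape
[SemiAnbd]-style decomposition-group dictionaries ((D3) `covering_subgraphComponents_doubleCosets` at a
finite level) produce.  Nothing here bears on [IUTchIII] Cor. 3.12 or takes a side; typed ≠ discharged.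
-/

namespace Literature.IUT.HodgeTheaters

open scoped Pointwise
open _root_.Topology

universe u

namespace StableCurveTemperedData

variable {D : StableCurveTemperedData.{u}}

namespace Prop24Tower

variable {T : D.Prop24Tower}

namespace SubgraphLevelData

variable (L : T.SubgraphLevelData)

/-- **B1 (c), tempered form, from its profinite (closure) form.**  If every tempered `γ ∈ Δ^tp_X`
stabilising `ℍ̃_i` satisfies `ι(γ) ∈ Δ̂_{X,ℍ} · (Ĵ_i ∩ Δ̂_X)` (the level-`i` decomposition-group dictionary,
profinite side), if `Δ̂_{X,ℍ}` is the closure of `ι(Δ^tp_{X,ℍ})` ([IUTchI] Cor. 2.3 (ii)) and the levels are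
open in `Δ̂_X`, then `γ ∈ Δ^tp_{X,ℍ} · J_i` with a TEMPERED first factor (`StabLeDeltaHLevel`): an open
coset meeting the closure of `ι(Δ^tp_{X,ℍ})` meets `ι(Δ^tp_{X,ℍ})`. [cite: Mochizuki2012, Cor 2.3(ii) p.47] -/
theorem stabLeDeltaHLevel_of_hat (h23ii : D.Cor23ii) (ho : T.LevelsOpen)
    (hhat : ∀ i (γ : D.DeltaTp), (∀ v ∈ L.compH i, L.act i (γ : D.PiTp) v ∈ L.compH i) →
      D.ιΔ γ ∈ (D.deltaHatH : Set D.DeltaHat) *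
        (((T.Jhat i).subgroupOf D.DeltaHat : Subgroup D.DeltaHat) : Set D.DeltaHat)) :
    L.StabLeDeltaHLevel := by
  intro i γ hst
  have hx := hhat i γ hst
  -- `Δ̂_{X,ℍ} = closure ι(Δ^tp_{X,ℍ})` (Cor. 2.3 (ii)), and `closure(A) · U = A · U` for `U` open
  have hcl : (D.deltaHatH : Set D.DeltaHat) = closure ((D.deltaTpH.map D.ιΔ : Subgroup D.DeltaHat) :
      Set D.DeltaHat) := by
    rw [← h23ii.closure_eq]; rfl
  rw [hcl, (ho i).closure_mul] at hx
  obtain ⟨a, ha, u, hu, hau⟩ := Set.mem_mul.mp hx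
  obtain ⟨k, hk, rfl⟩ := ha
  refine ⟨k, hk, ?_⟩
  -- `ι(k⁻¹ γ) = u ∈ Ĵ_i`
  have hu' : D.ιΔ (k⁻¹ * γ) = u := by
    rw [map_mul, map_inv, ← hau, inv_mul_cancel_left]
  rw [D.mem_levelTp]
  have : (D.ιΔ (k⁻¹ * γ) : D.PiHat) ∈ T.Jhat i := by
    rw [hu']; exact Subgroup.mem_subgroupOf.mp hu
  rwa [D.coe_ιΔ] at this

/-- **The carrier's `LevelTarget` from the PROFINITE dictionary**: base Cor. 2.3 (i)(ii), B3 `LevelIncidence`,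
the block property `IsBlock`, the levels open, and `hhat` (B1 (c) in closure form).
[cite: Mochizuki2012, Cor 2.3(vi) p.48] -/
theorem levelTarget_of_hat (h23i : D.Cor23i) (h23ii : D.Cor23ii) (ho : T.LevelsOpen)
    (hinc : L.LevelIncidence) (hblk : L.IsBlock)
    (hhat : ∀ i (γ : D.DeltaTp), (∀ v ∈ L.compH i, L.act i (γ : D.PiTp) v ∈ L.compH i) →
      D.ιΔ γ ∈ (D.deltaHatH : Set D.DeltaHat) *
        (((T.Jhat i).subgroupOf D.DeltaHat : Subgroup D.DeltaHat) : Set D.DeltaHat)) :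
    T.LevelTarget :=
  L.levelTarget_of_inputs h23i hinc hblk (L.stabLeDeltaHLevel_of_hat h23ii ho hhat)

end SubgraphLevelData

namespace CoveringLevelGraphs

variable (C : T.CoveringLevelGraphs)

/-- **`LevelTarget` at the semi-graph-covering instantiation from the PROFINITE dictionary**: with the B4
core discharged there (`toLevelData_isBlock`), the per-level target needs only base Cor. 2.3 (i)(ii), the
levels open, B3 `LevelIncidence`, and the closure-form dictionary `hhat`.
[cite: Mochizuki2012, Cor 2.3(vi) p.48] -/
theorem toLevelData_levelTarget_of_hat (h23i : D.Cor23i) (h23ii : D.Cor23ii) (ho : T.LevelsOpen)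
    (hinc : C.toLevelData.LevelIncidence)
    (hhat : ∀ i (γ : D.DeltaTp),
      (∀ v ∈ C.toLevelData.compH i, C.toLevelData.act i (γ : D.PiTp) v ∈ C.toLevelData.compH i) →
      D.ιΔ γ ∈ (D.deltaHatH : Set D.DeltaHat) *
        (((T.Jhat i).subgroupOf D.DeltaHat : Subgroup D.DeltaHat) : Set D.DeltaHat)) :
    T.LevelTarget :=
  C.toLevelData.levelTarget_of_hat h23i h23ii ho hinc C.toLevelData_isBlock hhat

end CoveringLevelGraphs

end Prop24Tower

end StableCurveTemperedData

end Literature.IUT.HodgeTheaters
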